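import Summits.MatrixMultiplication.MatrixMultiplication.Theorems.SaturationLadderChordLadder
import HarnessLib

/-!
# Saturation ladder — Kernel XXIV-A: corners and chords for sharp exponential saturation

Cell `decomp-mm`, lens `decomp-mm-lens-1` (grading / quantitative ladder), gen 52; supports the
deciding crux `SubexpSaturation` (item 25909) of `route-MatrixMultiplication-SaturationLadder`.
No new hypotheses, no `sorry`.  This is the certificate half of Kernel XXIV
(`SaturationLadderUniformDefect`), which proves `U(log 4)`: every `t ∈ [0,1)` is tight at some
`r ∈ [1, 4^{1/(1−t)}]` (item `ExpSaturation` without its factor `16`) and places it on the UNIFORM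
defect ladder of the summit.

* §1 entropy certificates of the X-perfect `CW_q` family (`tight_cwFamily`): at `(q,k) = (48,2)`
  (numeric, `log(125/64) ≤ 3/4`) and at `q = 3·4^k` for every `k ≥ 3` (parametric, using only
  `log(3/2) ≥ 1/3` and `log(2 + 1/k) ≤ log 2 + 1/(2k)`);
* §2 the CORNERS `P_k = (k/(k+1), r_k)` with `1 ≤ r_k ≤ 3·4^k·k/(k+1)` tight, for every `k ≥ 1`
  (`k = 1`: the tree's `T(1/2, 9/2)` from `CW_11`; `k = 2`: `T(2/3, 31)` from `CW_48`;
  `k ≥ 3`: `CW_{3·4^k}`);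
* §3 the CHORD BOUND: along the chord between `P_k` and `P_{k+1}` (parameter `s ∈ [0,1]`,
  `x = (k+1)s/(k+2)`) the length is `≤ 3·4^k(1+3x)` while `1/(1−t) = (k+1)(k+2)/(k+2−s) ≥ k+1+x`
  (`(k+2)² − s² ≤ (k+2)²`), and `3 + 9x ≤ 4·4^x` (tangents of `e^{x log 4}` at `0` and `1/2`), so the
  chord stays below `e^{log 4/(1−t)} = 4^{1/(1−t)}`.

A pure staircase of corners cannot reach base `4`: the least `q` satisfying the entropy condition at
grade `k` is `q_min(k) ≈ 2.03·4^k` (`11, 37, 139, 544, 2150, …`), so the least certifiable corner length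
is `r_k ≈ 2·4^k·k/(k+1) > 4^k = 4^{1/(1−t)}` at the left end `t ↓ (k−1)/k` of the grade-`k` step
(`k ≥ 2`); the chords (convexity of the tight region, Lotti–Romani) are essential.

[novel: the parametric certificate at `q = 3·4^k` and the chord inequality are this lineage's
bookkeeping; the laser-method input is Coppersmith–Winograd 1990 §6 / Le Gall 2014 App. A /
ADVWXXZ 2025 Thm 3.2 as packaged in `tight_cwFamily`.]
-/

set_option linter.dupNamespace false

namespace Summit.MatrixMultiplication.MatrixMultiplication.Theorems.SaturationLadderUniformCorners

open Literature.Computability.AlgebraicComplexity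
open Summit.MatrixMultiplication.MatrixMultiplication.Theorems.SaturationLadderExpSaturation
open Summit.MatrixMultiplication.MatrixMultiplication.Theorems.SaturationLadderChordLadder

noncomputable section

/-! ## §1 Entropy certificates: `q = 48` at grade `2`, and `q = 3·4^k` at every grade `k ≥ 3` -/

/-- The entropy condition of the X-perfect `CW_q` family at `(q,k) = (48,2)` (`θ = 1/50`, `p = 1/20`,
`ℓ = 5/2`): reduces to `log(125/64) ≤ 3/4`. [folklore] -/
theorem entropyCondition_fortyeight :
    2 * Real.negMulLog (1 / (((48 : ℕ) : ℝ) + 2)) + Real.negMulLog (1 - 2 * (1 / (((48 : ℕ) : ℝ) + 2))) ≤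
      Real.binEntropy ((2 * ((2 : ℕ) : ℝ) + 1) / ((((48 : ℕ) : ℝ) + 2) * ((2 : ℕ) : ℝ))) := by
  have e50 : (((48 : ℕ) : ℝ) + 2) = 50 := by norm_num
  refine entropyX_le_binEntropy_of (l := 5 / 2) (by norm_num) ?_ ?_ ?_ ?_ ?_
  · norm_num
  · norm_num
  · norm_num
  · norm_num
  · rw [e50]
    have h1 : Real.log (5 / 2) = Real.log 5 - Real.log 2 := Real.log_div (by norm_num) (by norm_num)
    have h2 : Real.log (1 / 50) = -Real.log 50 := by rw [one_div, Real.log_inv]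
    have h3 : Real.log 50 = Real.log 2 + 2 * Real.log 5 := by
      rw [show (50 : ℝ) = 2 * 5 ^ 2 by norm_num, Real.log_mul (by norm_num) (by norm_num), Real.log_pow]
      push_cast
      ring
    have h4 : 3 * Real.log 5 ≤ 7 * Real.log 2 := by
      have h := Real.log_le_log (by norm_num : (0 : ℝ) < 5 ^ 3) (by norm_num : (5 : ℝ) ^ 3 ≤ 2 ^ 7)
      rw [Real.log_pow, Real.log_pow] at h
      push_cast at h
      linarith
    have h5 := Real.log_two_lt_d9
    have e : (5 / 2 : ℝ) ^ 2 * (1 / 50) = 1 / 8 := by norm_num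
    rw [e, h2, h1, h3]
    linarith

/-- `18 k ≤ 4^k` for `k ≥ 3`. -/
theorem eighteen_mul_le_four_pow (k : ℕ) (hk : 3 ≤ k) : 18 * k ≤ 4 ^ k := by
  induction k, hk using Nat.le_induction with
  | base => norm_num
  | succ n hn ih =>
    have h64 : 64 ≤ 4 ^ n := by
      calc 64 = 4 ^ 3 := by norm_num
        _ ≤ 4 ^ n := Nat.pow_le_pow_right (by norm_num) hn
    calc 18 * (n + 1) = 18 * n + 18 := by ring
      _ ≤ 4 ^ n + 3 * 4 ^ n := by omega
      _ = 4 ^ (n + 1) := by ring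

/-- **Parametric entropy certificate at `q = 3·4^k`, `k ≥ 3`.**  With `θ = 1/(q+2)`, `ℓ = 2 + 1/k`,
`p = ℓθ = (2k+1)/((q+2)k)`: `2η(θ) + η(1−2θ) ≤ h(p)`.  Via the abstract form
(`entropyX_le_binEntropy_of`) it reduces to `1/(2k) + (2k+1)²/(k(q+2)) ≤ log(3/2)`, and
`log(3/2) ≥ 1 − 2/3 = 1/3 ≥ 1/6 + 1/6`. [folklore] -/
theorem entropyCondition_three_mul_four_pow (k : ℕ) (hk : 3 ≤ k) (q : ℕ) (hq : q = 3 * 4 ^ k) :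
    2 * Real.negMulLog (1 / ((q : ℝ) + 2)) + Real.negMulLog (1 - 2 * (1 / ((q : ℝ) + 2))) ≤
      Real.binEntropy ((2 * k + 1) / (((q : ℝ) + 2) * k)) := by
  have hk1 : 1 ≤ k := le_trans (by norm_num) hk
  have hK3 : (3 : ℝ) ≤ k := by exact_mod_cast hk
  have hK0 : (0 : ℝ) < k := by linarith
  have hqR : (q : ℝ) = 3 * (4 : ℝ) ^ k := by rw [hq]; push_cast; ring
  have h4k : (64 : ℝ) ≤ (4 : ℝ) ^ k := by
    have : (4 : ℝ) ^ 3 ≤ (4 : ℝ) ^ k := pow_le_pow_right₀ (by norm_num) hk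
    linarith
  have hq192 : (192 : ℝ) ≤ q := by rw [hqR]; linarith
  have hq2 : (0 : ℝ) < (q : ℝ) + 2 := by linarith
  have h18 : (18 : ℝ) * k ≤ (4 : ℝ) ^ k := by
    have h := eighteen_mul_le_four_pow k hk
    exact_mod_cast h
  refine entropyX_le_binEntropy_of (l := 2 + 1 / (k : ℝ)) (by positivity) ?_ ?_ ?_ ?_ ?_
  · rw [show 2 * (1 / ((q : ℝ) + 2)) = 2 / ((q : ℝ) + 2) by ring, div_lt_one hq2]
    linarith
  · field_simp
  · have : 0 ≤ 1 / (k : ℝ) := by positivity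
    linarith
  · rw [div_lt_one (by positivity)]
    nlinarith
  · -- the numerical condition `ℓ log ℓ + ℓ² θ ≤ (ℓ − 2)(1 − log θ)`
    set K : ℝ := (k : ℝ) with hKdef
    set Q : ℝ := (q : ℝ) with hQdef
    have hlogθ : Real.log (1 / (Q + 2)) = -Real.log (Q + 2) := by rw [one_div, Real.log_inv]
    -- `log (2 + 1/K) ≤ log 2 + 1/(2K)`
    have hlog2k : Real.log (2 + 1 / K) ≤ Real.log 2 + 1 / (2 * K) := by
      have e : 2 + 1 / K = 2 * (1 + 1 / (2 * K)) := by field_simp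
      rw [e, Real.log_mul two_ne_zero (by positivity)]
      have := Real.log_le_sub_one_of_pos (by positivity : (0 : ℝ) < 1 + 1 / (2 * K))
      linarith
    -- `log 3 + k log 4 ≤ log (Q + 2)`
    have hlogQ : Real.log 3 + K * (2 * Real.log 2) ≤ Real.log (Q + 2) := by
      have e4 : Real.log 4 = 2 * Real.log 2 := by
        rw [show (4 : ℝ) = 2 ^ 2 by norm_num, Real.log_pow]; (try norm_num)
      have hQ : Real.log Q = Real.log 3 + K * Real.log 4 := by
        rw [hqR, Real.log_mul (by norm_num) (by positivity), Real.log_pow]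
      have hle : Real.log Q ≤ Real.log (Q + 2) := Real.log_le_log (by linarith) (by linarith)
      rw [← e4]; linarith
    -- `1/3 ≤ log 3 − log 2`
    have hlog32 : 1 / 3 ≤ Real.log 3 - Real.log 2 := by
      have h := Real.one_sub_inv_le_log_of_pos (by norm_num : (0 : ℝ) < 3 / 2)
      rw [Real.log_div (by norm_num) (by norm_num)] at h
      norm_num at h
      linarith
    have h2K : 1 / (2 * K) ≤ 1 / 6 := one_div_le_one_div_of_le (by norm_num) (by linarith)
    -- the three comparisons
    have hA : (2 + 1 / K) * Real.log (2 + 1 / K) ≤ (2 + 1 / K) * (Real.log 2 + 1 / (2 * K)) :=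
      mul_le_mul_of_nonneg_left hlog2k (by positivity)
    have hB : (2 + 1 / K) ^ 2 * (1 / (Q + 2)) ≤ 1 / (6 * K) := by
      have e : (2 + 1 / K) ^ 2 * (1 / (Q + 2)) = (2 * K + 1) ^ 2 / (K ^ 2 * (Q + 2)) := by
        field_simp
      rw [e, div_le_div_iff₀ (by positivity) (by positivity), one_mul]
      have h9 : (2 * K + 1) ^ 2 ≤ 9 * K ^ 2 := by nlinarith
      have h54 : 54 * K ^ 3 ≤ K ^ 2 * Q := by
        calc 54 * K ^ 3 = 3 * K ^ 2 * (18 * K) := by ring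
          _ ≤ 3 * K ^ 2 * (4 : ℝ) ^ k := mul_le_mul_of_nonneg_left h18 (by positivity)
          _ = K ^ 2 * Q := by rw [hqR]; ring
      nlinarith [sq_nonneg K, hK0.le]
    have hC : (1 / K) * (1 + (Real.log 3 + K * (2 * Real.log 2))) ≤ (1 / K) * (1 + Real.log (Q + 2)) :=
      mul_le_mul_of_nonneg_left (by linarith) (by positivity)
    have hD : (2 + 1 / K) * (Real.log 2 + 1 / (2 * K)) + 1 / (6 * K) ≤
        (1 / K) * (1 + (Real.log 3 + K * (2 * Real.log 2))) := by
      rw [← sub_nonneg]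
      have e : (1 / K) * (1 + (Real.log 3 + K * (2 * Real.log 2))) -
          ((2 + 1 / K) * (Real.log 2 + 1 / (2 * K)) + 1 / (6 * K)) =
          (Real.log 3 - Real.log 2 - 1 / (2 * K) - 1 / 6) / K := by
        field_simp
        ring
      rw [e]
      exact div_nonneg (by linarith) hK0.le
    calc (2 + 1 / K) * Real.log (2 + 1 / K) + (2 + 1 / K) ^ 2 * (1 / (Q + 2))
        ≤ (2 + 1 / K) * (Real.log 2 + 1 / (2 * K)) + 1 / (6 * K) := add_le_add hA hB
      _ ≤ (1 / K) * (1 + (Real.log 3 + K * (2 * Real.log 2))) := hD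
      _ ≤ (1 / K) * (1 + Real.log (Q + 2)) := hC
      _ = (2 + 1 / K - 2) * (1 - Real.log (1 / (Q + 2))) := by rw [hlogθ]; ring

/-! ## §2 The corners `P_k = (k/(k+1), r_k)`, `r_k ≤ 3·4^k·k/(k+1)` -/

/-- `T(2/3, 31)`: `ω(1, 2/3, 31) ≤ 32`, i.e. `ω(3,2,93) = 96`, from `CW_48` at grade `2`
(`tight_cwFamily 48 2 93`). [cite: AlmanDuanVassilevskaWilliamsXuXuZhou2025, Thm. 3.2]
[cite: LeGall2014, Appendix A] [cite: CoppersmithWinograd1990, §6] -/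
theorem tight_twoThirds_thirtyOne : omegaRect ℂ 1 (2 / 3) 31 ≤ 1 + 31 := by
  have h := tight_cwFamily 48 2 93 (by norm_num) (by norm_num) (by norm_num) entropyCondition_fortyeight
  have e1 : ((2 : ℕ) : ℝ) / (((2 : ℕ) : ℝ) + 1) = 2 / 3 := by norm_num
  have e2 : ((93 : ℕ) : ℝ) / (((2 : ℕ) : ℝ) + 1) = 31 := by norm_num
  rw [e1, e2] at h
  exact h

/-- The corner at grade `k ≥ 3`: `T(k/(k+1), (3·4^k·k − k − 1)/(k+1))` from `CW_q`, `q = 3·4^k`.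
[cite: AlmanDuanVassilevskaWilliamsXuXuZhou2025, Thm. 3.2] [cite: HuangPan1998, §2 (2.8)] -/
theorem tight_corner_three_le (k : ℕ) (hk : 3 ≤ k) :
    omegaRect ℂ 1 ((k : ℝ) / ((k : ℝ) + 1)) (((3 * 4 ^ k * k - (k + 1) : ℕ) : ℝ) / ((k : ℝ) + 1)) ≤
      1 + ((3 * 4 ^ k * k - (k + 1) : ℕ) : ℝ) / ((k : ℝ) + 1) := by
  have h64 : 64 ≤ 4 ^ k := by
    calc 64 = 4 ^ 3 := by norm_num
      _ ≤ 4 ^ k := Nat.pow_le_pow_right (by norm_num) hk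
  have hqk : 3 * 4 ^ k * k = k + 1 + (3 * 4 ^ k * k - (k + 1)) := by
    have : k + 1 ≤ 3 * 4 ^ k * k := by nlinarith
    omega
  exact tight_cwFamily (3 * 4 ^ k) k _ (by omega) (by omega) hqk
    (entropyCondition_three_mul_four_pow k hk _ rfl)

/-- **The corners, uniformly**: for every grade `k ≥ 1` there is a tight length `r_k` at
`t_k = k/(k+1)` with `1 ≤ r_k ≤ 3·4^k·k/(k+1)` (`k = 1`: the tree's `T(1/2, 9/2)`; `k = 2`: `T(2/3, 31)`;
`k ≥ 3`: `CW_{3·4^k}`). [folklore] -/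
theorem corner (k : ℕ) (hk : 1 ≤ k) :
    ∃ r : ℝ, 1 ≤ r ∧ r ≤ 3 * (4 : ℝ) ^ k * k / ((k : ℝ) + 1) ∧
      omegaRect ℂ 1 ((k : ℝ) / ((k : ℝ) + 1)) r ≤ 1 + r := by
  rcases Nat.lt_or_ge k 3 with hlt | hge
  · interval_cases k
    · refine ⟨9 / 2, by norm_num, by norm_num, ?_⟩
      have e : ((1 : ℕ) : ℝ) / (((1 : ℕ) : ℝ) + 1) = 1 / 2 := by norm_num
      rw [e]
      exact tight_half_nineHalves
    · refine ⟨31, by norm_num, by norm_num, ?_⟩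
      have e : ((2 : ℕ) : ℝ) / (((2 : ℕ) : ℝ) + 1) = 2 / 3 := by norm_num
      rw [e]
      exact tight_twoThirds_thirtyOne
  · have h64 : (64 : ℝ) ≤ (4 : ℝ) ^ k := by
      have : (4 : ℝ) ^ 3 ≤ (4 : ℝ) ^ k := pow_le_pow_right₀ (by norm_num) hge
      linarith
    have hK3 : (3 : ℝ) ≤ k := by exact_mod_cast hge
    have h64n : 64 ≤ 4 ^ k := by
      calc 64 = 4 ^ 3 := by norm_num
        _ ≤ 4 ^ k := Nat.pow_le_pow_right (by norm_num) hge
    have hsub : k + 1 ≤ 3 * 4 ^ k * k := by nlinarith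
    have hcast : (((3 * 4 ^ k * k - (k + 1) : ℕ) : ℝ)) = 3 * (4 : ℝ) ^ k * k - (k + 1) := by
      rw [Nat.cast_sub hsub]
      push_cast
      ring
    refine ⟨(((3 * 4 ^ k * k - (k + 1) : ℕ) : ℝ)) / ((k : ℝ) + 1), ?_, ?_, tight_corner_three_le k hge⟩
    · rw [le_div_iff₀ (by positivity), hcast]
      nlinarith
    · rw [hcast]
      exact div_le_div_of_nonneg_right (by linarith) (by positivity)

/-! ## §3 The chord inequality: `3 + 9x ≤ 4·4^x` and `1/(1−t) ≥ k + 1 + x` along a chord -/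

/-- `1.3862 < log 4`. -/
theorem log_four_gt : (1.3862 : ℝ) < Real.log 4 := by
  have e4 : Real.log 4 = 2 * Real.log 2 := by
    rw [show (4 : ℝ) = 2 ^ 2 by norm_num, Real.log_pow]; (try norm_num)
  have := Real.log_two_gt_d9
  linarith

/-- `log 4 < 1.3863`. -/
theorem log_four_lt : Real.log 4 < (1.3863 : ℝ) := by
  have e4 : Real.log 4 = 2 * Real.log 2 := by
    rw [show (4 : ℝ) = 2 ^ 2 by norm_num, Real.log_pow]; (try norm_num)
  have := Real.log_two_lt_d9
  linarith

/-- **The one-variable inequality** `3 + 9x ≤ 4·4^x` on `[0,∞)` (minimum margin `0.348` at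
`x ≈ 0.349`), from the tangents of `4^x = e^{x log 4}` at `x = 0` (`x ≤ 11/40`) and at `x = 1/2`
(`4^{1/2} = 2`; `x ≥ 11/40`). [folklore] -/
theorem three_add_nine_mul_le {x : ℝ} (hx0 : 0 ≤ x) :
    3 + 9 * x ≤ 4 * Real.exp (x * Real.log 4) := by
  have hL1 := log_four_gt
  have hL2 := log_four_lt
  have e4 : Real.log 4 = 2 * Real.log 2 := by
    rw [show (4 : ℝ) = 2 ^ 2 by norm_num, Real.log_pow]; (try norm_num)
  rcases le_or_gt x (11 / 40) with h | h
  · have ht := Real.add_one_le_exp (x * Real.log 4)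
    have hm : x * 1.3862 ≤ x * Real.log 4 := mul_le_mul_of_nonneg_left hL1.le hx0
    linarith
  · have e2 : Real.exp (x * Real.log 4) = 2 * Real.exp ((x - 1 / 2) * Real.log 4) := by
      rw [show x * Real.log 4 = Real.log 2 + (x - 1 / 2) * Real.log 4 by rw [e4]; ring, Real.exp_add,
        Real.exp_log two_pos]
    have ht := Real.add_one_le_exp ((x - 1 / 2) * Real.log 4)
    rw [e2]
    rcases le_or_gt (1 / 2) x with h2 | h2
    · have hm : (x - 1 / 2) * 1.3862 ≤ (x - 1 / 2) * Real.log 4 :=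
        mul_le_mul_of_nonneg_left hL1.le (by linarith)
      linarith
    · have hm : (x - 1 / 2) * 1.3863 ≤ (x - 1 / 2) * Real.log 4 :=
        mul_le_mul_of_nonpos_left hL2.le (by linarith)
      linarith

/-- **The chord bound.**  Along the chord from `(k/(k+1), 3·4^k·k/(k+1))` to
`((k+1)/(k+2), 3·4^{k+1}(k+1)/(k+2))` with parameter `s ∈ [0,1]`, the length stays below
`4^{1/(1−t)} = e^{log 4/(1−t)}`: with `x = (k+1)s/(k+2)` the length is `≤ 3·4^k(1+3x)` and
`1/(1−t) = (k+1)(k+2)/(k+2−s) ≥ k+1+x` (`(k+2)² − s² ≤ (k+2)²`). [folklore] -/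
theorem chord_len_le (k : ℕ) {s : ℝ} (hs0 : 0 ≤ s) (hs1 : s ≤ 1) :
    (1 - s) * (3 * (4 : ℝ) ^ k * k / ((k : ℝ) + 1)) +
        s * (3 * (4 : ℝ) ^ (k + 1) * ((k : ℝ) + 1) / ((k : ℝ) + 1 + 1)) ≤
      Real.exp (Real.log 4 /
        (1 - ((1 - s) * ((k : ℝ) / ((k : ℝ) + 1)) + s * (((k : ℝ) + 1) / ((k : ℝ) + 1 + 1))))) := by
  set K : ℝ := (k : ℝ) with hKdef
  have hK0 : (0 : ℝ) ≤ K := Nat.cast_nonneg _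
  have h4k : (0 : ℝ) < (4 : ℝ) ^ k := by positivity
  have hL0 : 0 < Real.log 4 := Real.log_pos (by norm_num)
  set x : ℝ := (K + 1) * s / (K + 1 + 1) with hxdef
  have hx0 : 0 ≤ x := by positivity
  have hxs : x ≤ s := by
    rw [hxdef, div_le_iff₀ (by positivity)]
    nlinarith
  have hx1 : x ≤ 1 := hxs.trans hs1
  -- the length is at most `3·4^k (1 + 3x)`
  have hfrac : 3 * (4 : ℝ) ^ k * K / (K + 1) ≤ 3 * (4 : ℝ) ^ k := by
    rw [div_le_iff₀ (by positivity)]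
    nlinarith
  have hlen : (1 - s) * (3 * (4 : ℝ) ^ k * K / (K + 1)) +
      s * (3 * (4 : ℝ) ^ (k + 1) * (K + 1) / (K + 1 + 1)) ≤ (4 : ℝ) ^ k * (3 + 9 * x) := by
    have h1 : (1 - s) * (3 * (4 : ℝ) ^ k * K / (K + 1)) ≤ (1 - s) * (3 * (4 : ℝ) ^ k) :=
      mul_le_mul_of_nonneg_left hfrac (by linarith)
    have h2 : s * (3 * (4 : ℝ) ^ (k + 1) * (K + 1) / (K + 1 + 1)) = (4 : ℝ) ^ k * (12 * x) := by
      rw [hxdef, pow_succ]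
      field_simp
      ring
    rw [h2]
    nlinarith [mul_nonneg (sub_nonneg.2 hxs) h4k.le]
  -- the exponent: `k + 1 + x ≤ 1/(1−t)`
  have h1t : 1 - ((1 - s) * (K / (K + 1)) + s * ((K + 1) / (K + 1 + 1))) =
      (K + 2 - s) / ((K + 1) * (K + 2)) := by
    field_simp
    ring
  have hden : 0 < K + 2 - s := by linarith
  have hkey : K + 1 + x ≤ (K + 1) * (K + 2) / (K + 2 - s) := by
    rw [le_div_iff₀ hden, hxdef, show K + 1 + 1 = K + 2 by ring]
    have e : (K + 1 + (K + 1) * s / (K + 2)) * (K + 2 - s) = (K + 1) * ((K + 2) ^ 2 - s ^ 2) / (K + 2) := by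
      field_simp
      ring
    rw [e, div_le_iff₀ (by positivity)]
    nlinarith [sq_nonneg s, hK0]
  have hexp_arg : (K + 1 + x) * Real.log 4 ≤
      Real.log 4 / (1 - ((1 - s) * (K / (K + 1)) + s * ((K + 1) / (K + 1 + 1)))) := by
    rw [h1t, div_div_eq_mul_div]
    -- `log 4 * ((K+1)(K+2)) / (K+2−s) = log 4 * ((K+1)(K+2)/(K+2−s))`
    rw [mul_div_assoc, mul_comm]
    exact mul_le_mul_of_nonneg_left hkey hL0.le
  -- combine
  have hA := three_add_nine_mul_le hx0
  have hpow : (4 : ℝ) ^ k * 4 = Real.exp ((K + 1) * Real.log 4) := by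
    have ek : ((k : ℝ) + 1) = ((k + 1 : ℕ) : ℝ) := by push_cast; ring
    rw [hKdef, ek, Real.exp_nat_mul, Real.exp_log (by norm_num : (0 : ℝ) < 4), pow_succ]
  calc (1 - s) * (3 * (4 : ℝ) ^ k * K / (K + 1)) + s * (3 * (4 : ℝ) ^ (k + 1) * (K + 1) / (K + 1 + 1))
      ≤ (4 : ℝ) ^ k * (3 + 9 * x) := hlen
    _ ≤ (4 : ℝ) ^ k * (4 * Real.exp (x * Real.log 4)) := mul_le_mul_of_nonneg_left hA h4k.le
    _ = Real.exp ((K + 1) * Real.log 4) * Real.exp (x * Real.log 4) := by rw [← hpow]; ring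
    _ = Real.exp ((K + 1 + x) * Real.log 4) := by rw [← Real.exp_add]; ring_nf
    _ ≤ _ := Real.exp_le_exp.2 hexp_arg

end

end Summit.MatrixMultiplication.MatrixMultiplication.Theorems.SaturationLadderUniformCorners
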